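import Literature.Topology.FourManifolds.GluckTwistHomology
import Literature.Topology.FourManifolds.GluckTwistSimplyConnected
import Literature.Topology.FourManifolds.GluckTwistMeridian
import Literature.AlgebraicTopology.SingularHomology.SphereComplement
import Literature.AlgebraicTopology.SingularHomology.SphereComplementProofs
import HarnessLib

/-!
# The Hatcher 2B.1 leaf of the Gluck-twist fact, discharged

Sibling file of `GluckTwistHomology.lean` in the decomposition (D-0014 provefact, XL) of the route
fact `Literature.Topology.FourManifolds.gluck_homeomorph_sphere_four` (`GluckTwistFacts.lean`: *a Gluck twist of `S⁴` along a
2-knot is homeomorphic to `S⁴`*, Gluck, Trans. AMS 104 (1962), §17 + Freedman, J. Differential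
Geom. 17 (1982), Thm. 1.6). `Literature.Topology.FourManifolds.gluck_homeomorph_sphere_four_of_mayerVietoris`
(`GluckTwistHomology.lean`) assembles the route fact from

* `hπ`: Gluck twists are simply connected (reduced in `GluckTwistSimplyConnected.lean` to
  Kervaire's lemma `TwoKnot.normalClosure_meridian_eq_top`);
* `hexc`, `h₂`, `h₃`, `hS`: excision, Mayer–Vietoris exactness and the homology of spheres for
  singular homology with `ℤ` coefficients (named facts of `ExcisionMayerVietoris.lean`);
* `h2B1 : isZero_singularHomology_sphere_compl_sphere` (Hatcher, *Algebraic Topology*,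
  Prop. 2B.1(b): `Hᵢ(Sⁿ ∖ h(Sᵏ); ℤ) = 0` for `i ≠ 0, n - k - 1`);
* `hS10` (recognition of homotopy 4-spheres, `spc4.S10`) and `hF` (Freedman's theorem,
  `spc4.S04`).

Here the leaf `h2B1` is **proved** from `hexc`, `h₃`, `hS`
(`isZero_singularHomology_sphere_compl_sphere_of_mayerVietoris`, a specialisation of
`Literature.AlgebraicTopology.SingularHomology.SphereComplement.isZero_compl_range_of_isEmbedding` of
`Literature/AlgebraicTopology/SingularHomology/SphereComplement.lean`, where Hatcher's proof —
Mayer–Vietoris over the two hemispheres plus the bisection/compact-support argument of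
Prop. 2B.1(a) — is carried out), and the assembly is restated without it
(`gluck_homeomorph_sphere_four_of_mayerVietoris'`), from Kervaire's lemma
(`gluck_homeomorph_sphere_four_of_kervaire`) and, Kervaire's lemma being proved in
`GluckTwistMeridian.lean` (`TwoKnot.normalClosure_meridian_eq_top_holds`), from the textbook
homology facts alone (`gluck_homeomorph_sphere_four_of_homology_facts`). The hypotheses that remain
are exactly: the four singular-homology facts `hexc`, `h₂`, `h₃`, `hS` (Hatcher Thm. 2.20, §2.2,
Cor. 2.14), `spc4.S10` and Freedman's theorem; every Gluck-specific and knot-theoretic input of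
Gluck's §17 argument is proved.

**Update.** The Mayer–Vietoris injectivity criterion and the homology of spheres being proved
unconditionally (`SphereComplementProofs.lean`, `ExcisionMayerVietorisProofs.lean`, from the
concrete Mayer–Vietoris sequence of `LocalHomology.lean`), the named fact is now **discharged**:
`isZero_singularHomology_sphere_compl_sphere_holds` (Hatcher's Prop. 2B.1(b), vanishing part, for
arbitrary embeddings `Sᵏ → Sⁿ`). For the route fact itself the strongest assembly in the tree is
`Literature.Topology.FourManifolds.gluck_homeomorph_sphere_four_of_spc4` (`GluckTwistHomologyProofs.lean`: from `spc4.S10` and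
Freedman's theorem alone, the `H₂(Σ_K) = 0` leaf being proved there in the concrete model with the
case `(4, 2, 2)` of Prop. 2B.1(b) for tubed knots); the assemblies of this file, which keep the
named-fact Mayer–Vietoris hypotheses of `GluckTwistHomology.lean`, are weaker and kept for the
record.

## References

* H. Gluck, *The embedding of two-spheres in the four-sphere*, Trans. Amer. Math. Soc. 104 (1962)
  308–333, §17 [GluckTAMS1962].
* A. Hatcher, *Algebraic Topology* (2002), §2.B Prop. 2B.1 [HatcherAT2002].
* M. A. Kervaire, Bull. Soc. Math. France 93 (1965) 225–271, Ch. I Lemme 1.2 [KervaireBSMF1965].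
* M. Freedman, J. Differential Geom. 17 (1982), Thm. 1.6 [FreedmanJDG1982].

## Design notes

* No declaration in this file uses `sorry`; nothing is asserted.
-/

noncomputable section

open Set

namespace Literature.Topology.FourManifolds

/-- Local notation: `𝔼 n` is the model Euclidean space `EuclideanSpace ℝ (Fin n)`. -/
local notation "𝔼 " n:arg => EuclideanSpace ℝ (Fin n)

/-- **Hatcher's Prop. 2B.1(b), vanishing part, from the singular-homology facts.** The named fact
`isZero_singularHomology_sphere_compl_sphere` (`Hᵢ(Sⁿ ∖ h(Sᵏ); ℤ) = 0` for an embedding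
`h : Sᵏ → Sⁿ`, `k < n`, `i ≠ 0, n - k - 1`) follows from excision, Mayer–Vietoris exactness at
`Hₙ(U ∩ V)` and the homology of spheres (Hatcher, *Algebraic Topology*, Prop. 2B.1; proof in
`SphereComplement.lean`). [cite: HatcherAT2002, Prop. 2B.1(b)] -/
theorem isZero_singularHomology_sphere_compl_sphere_of_mayerVietoris
    (hexc : ∀ (T : Type) [TopologicalSpace T],
      Literature.AlgebraicTopology.SingularHomology.relativeSingularHomology.isIso_map_of_interior_union_interior ℤ ℤ T)
    (h₃ : ∀ (T : Type) [TopologicalSpace T] (U V : Set T), Literature.AlgebraicTopology.SingularHomology.mayerVietoris.exact₃ ℤ ℤ U V)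
    (hS : Literature.AlgebraicTopology.SingularHomology.isZero_singularHomology_sphere ℤ ℤ) : isZero_singularHomology_sphere_compl_sphere :=
  fun h he hkn hi0 hin =>
    Literature.AlgebraicTopology.SingularHomology.SphereComplement.isZero_compl_range_of_isEmbedding hexc h₃ hS h he hkn hi0 hin

/-- **The route fact `gluck_homeomorph_sphere_four` from `π₁`-triviality of Gluck twists, the
singular-homology facts, `spc4.S10` and Freedman's theorem** — the assembly
`gluck_homeomorph_sphere_four_of_mayerVietoris` of `GluckTwistHomology.lean` with its hypothesis
`h2B1` (Hatcher Prop. 2B.1(b)) now proved. [cite: GluckTAMS1962, §17] -/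
theorem gluck_homeomorph_sphere_four_of_mayerVietoris'
    (hπ : ∀ (K : TwoKnot) {X : Type} [TopologicalSpace X] [ChartedSpace (𝔼 4) X],
      simplyConnectedSpace_of_isGluckTwist (IX := modelWithCornersSelf ℝ (𝔼 4)) (X := X)
        (K := K))
    (hexc : ∀ (T : Type) [TopologicalSpace T],
      Literature.AlgebraicTopology.SingularHomology.relativeSingularHomology.isIso_map_of_interior_union_interior ℤ ℤ T)
    (h₂ : ∀ (T : Type) [TopologicalSpace T] (U V : Set T), Literature.AlgebraicTopology.SingularHomology.mayerVietoris.exact₂ ℤ ℤ U V)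
    (h₃ : ∀ (T : Type) [TopologicalSpace T] (U V : Set T), Literature.AlgebraicTopology.SingularHomology.mayerVietoris.exact₃ ℤ ℤ U V)
    (hS : Literature.AlgebraicTopology.SingularHomology.isZero_singularHomology_sphere ℤ ℤ)
    (hS10 : FourManifolds.nonempty_homotopyEquiv_sphere_four_iff.{0})
    (hF : FourManifolds.nonempty_homeomorph_sphere_four.{0}) : gluck_homeomorph_sphere_four :=
  gluck_homeomorph_sphere_four_of_mayerVietoris hπ hexc h₂ h₃ hS
    (isZero_singularHomology_sphere_compl_sphere_of_mayerVietoris hexc h₃ hS) hS10 hF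

/-- **The route fact `gluck_homeomorph_sphere_four` from its remaining leaves**: Kervaire's lemma
(the group of a 2-knot is normally generated by a meridian, `TwoKnot.normalClosure_meridian_eq_top`,
Kervaire 1965 Lemme 1.2), the singular-homology facts (excision, Mayer–Vietoris exactness,
homology of spheres; Hatcher Thm. 2.20, §2.2, Cor. 2.14), the recognition of homotopy 4-spheres
`spc4.S10` and Freedman's theorem `spc4.S04` (Gluck, Trans. AMS 104 (1962), §17: `Σ_K` is a
simply connected homology 4-sphere; Freedman, J. Differential Geom. 17 (1982), Thm. 1.6).
[cite: GluckTAMS1962, §17] -/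
theorem gluck_homeomorph_sphere_four_of_kervaire (hK : TwoKnot.normalClosure_meridian_eq_top)
    (hexc : ∀ (T : Type) [TopologicalSpace T],
      Literature.AlgebraicTopology.SingularHomology.relativeSingularHomology.isIso_map_of_interior_union_interior ℤ ℤ T)
    (h₂ : ∀ (T : Type) [TopologicalSpace T] (U V : Set T), Literature.AlgebraicTopology.SingularHomology.mayerVietoris.exact₂ ℤ ℤ U V)
    (h₃ : ∀ (T : Type) [TopologicalSpace T] (U V : Set T), Literature.AlgebraicTopology.SingularHomology.mayerVietoris.exact₃ ℤ ℤ U V)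
    (hS : Literature.AlgebraicTopology.SingularHomology.isZero_singularHomology_sphere ℤ ℤ)
    (hS10 : FourManifolds.nonempty_homotopyEquiv_sphere_four_iff.{0})
    (hF : FourManifolds.nonempty_homeomorph_sphere_four.{0}) : gluck_homeomorph_sphere_four :=
  gluck_homeomorph_sphere_four_of_mayerVietoris'
    (fun K => simplyConnectedSpace_of_isGluckTwist_of_euclidean (K := K) hK) hexc h₂ h₃ hS hS10 hF

/-- **The route fact `gluck_homeomorph_sphere_four` from the textbook homology facts, `spc4.S10` and
Freedman's theorem.** Every Gluck-specific input of Gluck's argument (Trans. AMS 104 (1962), §17: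
`Σ_K` is a closed, simply connected 4-manifold with `H₂(Σ_K; ℤ) = 0`) is now proved — compactness
(`GluckTwistProofs.lean`), simple connectivity via Kervaire's lemma
(`TwoKnot.normalClosure_meridian_eq_top_holds`, `GluckTwistMeridian.lean`), `H₂ = 0` modulo the
homology facts (`GluckTwistHomology.lean`) including Hatcher's Prop. 2B.1(b)
(`isZero_singularHomology_sphere_compl_sphere_of_mayerVietoris`) — so the route fact rests on:
excision and Mayer–Vietoris exactness for singular homology and the homology of spheres (Hatcher,
*Algebraic Topology*, Thm. 2.20, §2.2, Cor. 2.14; named facts of `ExcisionMayerVietoris.lean`), the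
`π₁`/`H₂` characterisation of homotopy 4-spheres (`spc4.S10`) and Freedman's theorem (`spc4.S04`,
J. Differential Geom. 17 (1982), Thm. 1.6). [cite: GluckTAMS1962, §17]
[cite: FreedmanJDG1982, Thm. 1.6] -/
theorem gluck_homeomorph_sphere_four_of_homology_facts
    (hexc : ∀ (T : Type) [TopologicalSpace T],
      Literature.AlgebraicTopology.SingularHomology.relativeSingularHomology.isIso_map_of_interior_union_interior ℤ ℤ T)
    (h₂ : ∀ (T : Type) [TopologicalSpace T] (U V : Set T), Literature.AlgebraicTopology.SingularHomology.mayerVietoris.exact₂ ℤ ℤ U V)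
    (h₃ : ∀ (T : Type) [TopologicalSpace T] (U V : Set T), Literature.AlgebraicTopology.SingularHomology.mayerVietoris.exact₃ ℤ ℤ U V)
    (hS : Literature.AlgebraicTopology.SingularHomology.isZero_singularHomology_sphere ℤ ℤ)
    (hS10 : FourManifolds.nonempty_homotopyEquiv_sphere_four_iff.{0})
    (hF : FourManifolds.nonempty_homeomorph_sphere_four.{0}) : gluck_homeomorph_sphere_four :=
  gluck_homeomorph_sphere_four_of_kervaire TwoKnot.normalClosure_meridian_eq_top_holds hexc h₂ h₃
    hS hS10 hF

/-! ### The named fact discharged -/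

/-- **Discharge of the named fact `Literature.Topology.FourManifolds.isZero_singularHomology_sphere_compl_sphere`** (Hatcher,
*Algebraic Topology*, Prop. 2B.1(b), vanishing part: `Hᵢ(Sⁿ ∖ h(Sᵏ); ℤ) = 0` for an embedding
`h : Sᵏ → Sⁿ`, `k < n`, `i ≠ 0, n - k - 1`), by
`SphereComplement.isZero_compl_range_of_isEmbedding_holds` (Mayer–Vietoris over the hemispheres,
bisection and compact supports for part (a), the homology of spheres for the base case — all
proved). [cite: HatcherAT2002, Prop. 2B.1(b)] -/
theorem isZero_singularHomology_sphere_compl_sphere_holds :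
    isZero_singularHomology_sphere_compl_sphere :=
  fun h he hkn hi0 hin =>
    Literature.AlgebraicTopology.SingularHomology.SphereComplement.isZero_compl_range_of_isEmbedding_holds ℤ ℤ h he hkn hi0 hin

end Literature.Topology.FourManifolds
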